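import Literature.NumberTheory.EllipticCurves.SubgroupSelmer
import HarnessLib

/-!
# `H¹_cont(G, M)` under an isomorphism of discrete coefficient modules; transport of kernels

Glue on top of the tree's compatible-pair API for continuous `H¹` of discrete modules
(`Literature.NumberTheory.EllipticCurves.discreteH1`, `Literature.NumberTheory.EllipticCurves.resHomOfEquivariant`, `Literature.NumberTheory.EllipticCurves.resKer` of `GaloisAction`; `Literature.NumberTheory.EllipticCurves.resH1Hom`,
`resH1Hom_id`, `resH1Hom_comp`, `resH1Hom_congr` of `SubgroupSelmer`, i.e. Mathlib's
`ContinuousCohomology.map`, `map_id`, `map_comp`), needed to transport Galois-cohomological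
invariants (`H¹(K, E)`, the Tate–Shafarevich group) along an isomorphism of Galois modules such
as `E(K̄) ≃ E'(K̄)` for a change of Weierstrass equation (Silverman, *AEC*, X.§4):

* `Literature.h1Equiv θ hθ : H¹(G, M) ≃+ H¹(G, M')` for a `G`-equivariant isomorphism `θ : M ≃+ M'`
  (the maps of the pairs `(id, θ)`, `(id, θ⁻¹)`, mutually inverse by functoriality);
* `Literature.NumberTheory.EllipticCurves.mem_resKer_iff_h1Equiv_mem`: the kernels `Literature.NumberTheory.EllipticCurves.resKer` of two compatible pairs
  `(φ, ψ : M → N)`, `(φ, ψ' : M' → N')` intertwined by equivariant isomorphisms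
  (`ψ' ∘ θ = θ_N ∘ ψ`) correspond under `h1Equiv θ`.

Everything here is proved (bookkeeping; no number theory).

## References

* J.-P. Serre, *Galois Cohomology*, Springer (1997), I.§2.2, I.§2.4 (compatible pairs).
* J. Neukirch, A. Schmidt, K. Wingberg, *Cohomology of Number Fields*, 2nd ed. (2008), I.§5.
-/

noncomputable section

namespace Literature.NumberTheory.EllipticCurves

universe u

variable {G : Type u} [Group G] [TopologicalSpace G] [IsTopologicalGroup G]
variable {H : Type u} [Group H] [TopologicalSpace H] [IsTopologicalGroup H]
variable {H' : Type u} [Group H'] [TopologicalSpace H'] [IsTopologicalGroup H']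
variable {M : Type u} [AddCommGroup M] [DistribMulAction G M] [TopologicalSpace M]
  [DiscreteTopology M]
variable {M' : Type u} [AddCommGroup M'] [DistribMulAction G M'] [TopologicalSpace M']
  [DiscreteTopology M']
variable {N : Type u} [AddCommGroup N] [DistribMulAction H N] [TopologicalSpace N]
  [DiscreteTopology N]
variable {N' : Type u} [AddCommGroup N'] [DistribMulAction H N'] [TopologicalSpace N']
  [DiscreteTopology N']
variable {P : Type u} [AddCommGroup P] [DistribMulAction H' P] [TopologicalSpace P]
  [DiscreteTopology P]

/-! ### Pointwise functoriality -/

/-- `resH1Hom` applied twice is `resH1Hom` of the composite compatible pair (pointwise form of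
`resH1Hom_comp`, Mathlib `ContinuousCohomology.map_comp`). Serre, *Galois Cohomology*, I.§2.4.
[folklore] -/
theorem resH1Hom_resH1Hom (φ : H →ₜ* G) (ψ : M →+ N)
    (h : ∀ (x : H) (m : M), ψ (φ x • m) = x • ψ m) (φ' : H' →ₜ* H) (ψ' : N →+ P)
    (h' : ∀ (x : H') (n : N), ψ' (φ' x • n) = x • ψ' n) (c : discreteH1 G M) :
    resH1Hom φ' ψ' h' (resH1Hom φ ψ h c) =
      resH1Hom (φ.comp φ') (ψ'.comp ψ) (fun x m ↦ by simp [h, h']) c := by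
  rw [← resH1Hom_comp]
  rfl

/-! ### Isomorphisms of coefficient modules -/

omit [TopologicalSpace G] [IsTopologicalGroup G] [TopologicalSpace M] [DiscreteTopology M]
  [TopologicalSpace M'] [DiscreteTopology M'] in
/-- The inverse of a `G`-equivariant additive isomorphism is `G`-equivariant. [folklore] -/
theorem symm_equivariant (θ : M ≃+ M') (hθ : ∀ (g : G) (m : M), θ (g • m) = g • θ m)
    (g : G) (m' : M') : θ.symm (g • m') = g • θ.symm m' := by
  apply θ.injective
  rw [AddEquiv.apply_symm_apply, hθ, AddEquiv.apply_symm_apply]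

/-- **A `G`-equivariant isomorphism of discrete `G`-modules induces an isomorphism on `H¹`**:
`H¹(G, M) ≃+ H¹(G, M')`, the maps of the compatible pairs `(id, θ)` and `(id, θ⁻¹)`
(`Literature.NumberTheory.EllipticCurves.resH1Hom`), mutually inverse by functoriality (`resH1Hom_comp`, `resH1Hom_id`).
Serre, *Galois Cohomology*, I.§2.4. [folklore] -/
def h1Equiv (θ : M ≃+ M') (hθ : ∀ (g : G) (m : M), θ (g • m) = g • θ m) :
    discreteH1 G M ≃+ discreteH1 G M' where
  toFun := resH1Hom (ContinuousMonoidHom.id G) (θ : M →+ M') hθ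
  invFun := resH1Hom (ContinuousMonoidHom.id G) (θ.symm : M' →+ M) (symm_equivariant θ hθ)
  left_inv c := by
    rw [resH1Hom_resH1Hom]
    have e : resH1Hom ((ContinuousMonoidHom.id G).comp (ContinuousMonoidHom.id G))
        ((θ.symm : M' →+ M).comp (θ : M →+ M'))
        (fun x m ↦ by simp) =
          resH1Hom (ContinuousMonoidHom.id G) (AddMonoidHom.id M) (fun _ _ ↦ rfl) :=
      resH1Hom_congr rfl (by ext m; simp) _ _
    rw [e, resH1Hom_id]
    rfl
  right_inv c := by
    rw [resH1Hom_resH1Hom]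
    have e : resH1Hom ((ContinuousMonoidHom.id G).comp (ContinuousMonoidHom.id G))
        ((θ : M →+ M').comp (θ.symm : M' →+ M))
        (fun x m ↦ by simp) =
          resH1Hom (ContinuousMonoidHom.id G) (AddMonoidHom.id M') (fun _ _ ↦ rfl) :=
      resH1Hom_congr rfl (by ext m; simp) _ _
    rw [e, resH1Hom_id]
    rfl
  map_add' := map_add _

/-- `h1Equiv θ` is `resH1Hom (id, θ)` as a function (by definition). [folklore] -/
theorem h1Equiv_apply (θ : M ≃+ M') (hθ : ∀ (g : G) (m : M), θ (g • m) = g • θ m)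
    (c : discreteH1 G M) :
    h1Equiv θ hθ c = resH1Hom (ContinuousMonoidHom.id G) (θ : M →+ M') hθ c :=
  rfl

/-! ### Kernels of compatible pairs under isomorphisms of coefficients -/

/-- **Kernels of intertwined compatible pairs correspond.** Let `(φ, ψ : M → N)` and
`(φ, ψ' : M' → N')` be compatible pairs along the same `φ : H → G`, and let `θ : M ≃+ M'`
(`G`-equivariant) and `θ_N : N ≃+ N'` (`H`-equivariant) intertwine them, `ψ' ∘ θ = θ_N ∘ ψ`.
Then a class `c ∈ H¹(G, M)` dies under `(φ, ψ)` iff `θ_* c ∈ H¹(G, M')` dies under `(φ, ψ')`: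
by functoriality `ψ'_* θ_* = (θ_N)_* ψ_*` on `H¹` (`resH1Hom_comp`, both being the map of the
pair `(φ, ψ' ∘ θ)`), and `(θ_N)_*` is injective (`h1Equiv θ_N`).
Serre, *Galois Cohomology*, I.§2.4. [folklore] -/
theorem mem_resKer_iff_h1Equiv_mem (φ : H →ₜ* G) (ψ : M →+ N)
    (h : ∀ (x : H) (m : M), ψ (φ x • m) = x • ψ m) (ψ' : M' →+ N')
    (h' : ∀ (x : H) (m' : M'), ψ' (φ x • m') = x • ψ' m') (θ : M ≃+ M')
    (hθ : ∀ (g : G) (m : M), θ (g • m) = g • θ m) (θN : N ≃+ N')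
    (hθN : ∀ (x : H) (n : N), θN (x • n) = x • θN n) (hsq : ∀ m : M, ψ' (θ m) = θN (ψ m))
    (c : discreteH1 G M) : c ∈ resKer φ ψ h ↔ h1Equiv θ hθ c ∈ resKer φ ψ' h' := by
  rw [resKer_eq_ker, resKer_eq_ker, AddMonoidHom.mem_ker, AddMonoidHom.mem_ker, h1Equiv_apply,
    resH1Hom_resH1Hom]
  -- both paths around the square are `resH1Hom` of the same pair `(φ, ψ' ∘ θ = θ_N ∘ ψ)`
  have e : resH1Hom ((ContinuousMonoidHom.id G).comp φ) (ψ'.comp (θ : M →+ M'))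
      (fun x m ↦ by simp [hθ, h']) =
        resH1Hom (φ.comp (ContinuousMonoidHom.id H)) ((θN : N →+ N').comp ψ)
          (fun x m ↦ by simp [h, hθN]) :=
    resH1Hom_congr (by ext; rfl) (by ext m; exact hsq m) _ _
  rw [e, ← resH1Hom_resH1Hom]
  change _ ↔ h1Equiv θN hθN (resH1Hom φ ψ h c) = 0
  rw [map_eq_zero_iff _ (h1Equiv θN hθN).injective]

end Literature.NumberTheory.EllipticCurves

end
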